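import Literature.MathematicalPhysics.QuantumFieldTheory.Balaban1983to89.B8Prop5KLevelLetters
import Literature.MathematicalPhysics.QuantumFieldTheory.Balaban1983to89.B8Prop5SocketDatum
import Literature.MathematicalPhysics.QuantumFieldTheory.Balaban1983to89.B8Eq191FlatStencils
import Literature.MathematicalPhysics.QuantumFieldTheory.Balaban1983to89.B8LambdaSpaceKLevel
import Literature.Analysis.Calculus.ExpDuhamel
import HarnessLib

/-!
# `hP1room` PROGRAMME (LEAD-H «H = hSupU» BOARD v2 (S3)), (A-1) STAGE 3a: ★★ TWO CONTENT ROWS OF THE SUPPLIER DOOR FROM THE TOP STEP's OUTPUT —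
# [R-d] N05's Landau condition of record for the gauge-fixed `ℤᵈ` field and [R-b] its near-`1` size, from the (1.108) sizes of `λ′`, the multiplier form of
# ✓`P1FlatCoreTopStepTorus.hFP_kLevel_top_RD` and the level-`0` size of the input one-form

Route `UnitScaleTilt`, crux K1 child «MinimiserStabilityRegPr» (stmt-QuantumFields-19200), registered stub `stub_halvingStep` (`BirthV10`), text `hP1room ⟸ hSupU`;
the rows fed are `hLanW` and `hnear` of ✓`HalvingP1FlatCoreSupplierDoor.hSup_of_contentRows` ((A-1) STAGE 2).  Cell `ym3-torus` (HUMAN RULING D-0037: YM₃ on T³ is ladder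
rung R3 — NOT d = 4, NOT a mass gap, NOT the Clay problem), width seat `ym-ust-20520-w3` gen 6.  `--supports stmt-QuantumFields-19200 --as helper`; THEOREMS ONLY
(0 `def`, 0 `sorry`); count-neutral; nothing here claims `core′`, `hP1room`, `hSupU`, the stub, the crux or the gap.

WHAT.  On `ℤᵈ` (`0 < d`), in any complete normed `ℂ`-algebra with `‖1‖ = 1`, at the flat background, spacing `η > 0`, Dirichlet window `Ω₀`, restriction tower `Λs`,
level-`0` bond set `Eb₀` covering the stars of `Ω₀` (`hEbΩ`, = ✓p636261's `hEbΩ` at `j = 0`):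
* ★★ `isLandau138W_of_topStepOutput` — if `λ` has the (1.108) sizes `‖λ(b₋)‖ ≤ α₄`, `(L⁰η)·‖(D^η_{1,κ}λ)(b₋)‖ ≤ α₄` on `Eb₀` (✓p636261's conjunct 3 at `j = 0`), the input
  one-form has `(L⁰η)·‖A‖, (L⁰η)·‖R(·)A‖ ≤ c_A` on `Ω₀` (its `hA` at `j = 0`), `α₄ ≤ 1∕70`, `c_A ≤ 1∕12`, and the multiplier form of the Landau equation holds on `Ω₀` (its conjunct 4
  VERBATIM), then `IsLandau138W L m η Ω₀ Λs 1 (mgauge 1 (e^{iλ})⁻¹ (e^{iηA}))` (✓`B8Prop5KLevelLetters.isLandau138W_gaugeFixed_of_multiplier`, its four smallness rows read off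
  (1.108) through `D^{η*}_{1,μ}λ(x) = −R(1)(D^η_{1,μ}λ)(x − e_μ)` ✓`covDeriv_eq_neg_conjR_covDerivFwd`);
* ★ `norm_mgauge_gaugeFixed_sub_one_le` — `‖e^{−iλ(z)}e^{iηA(z,ν)}e^{iλ(z+e_ν)} − 1‖ ≤ e^{2α₄ + c} − 1` from `‖λ(z)‖, ‖λ(z+e_ν)‖ ≤ α₄`, `η‖A(z,ν)‖ ≤ c`, and
  ★ `norm_mgauge_gaugeFixed_sub_one_le_quarter` — `≤ 1∕4` for `α₄ ≤ 1∕70`, `c ≤ 1∕12` (`e^{x} ≤ 1 + x + x²`, `|x| ≤ 1`).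
HONEST SCOPE.  Bookkeeping of print's windows; no analysis; the suppliers of `λ` and of the sizes are ✓p636261 and the J3∕N05 hands.

References: T. Bałaban, CMP **99** (1985) 75–102 [Balaban1985RegularSpaces] ((1.36)–(1.38) p.82, (1.84)–(1.90) pp.90–91, Prop. 5 (1.107)–(1.108) p.94);
CMP **98** (1985) 17–51 [Balaban1985Averaging] ((55) p.27, (21)–(26) p.21).
-/

set_option autoImplicit false

noncomputable section

open scoped BigOperators
open NormedSpace
open Complex (I)

namespace Summit.QuantumFields.YangMills.Theorems.HalvingP1FlatCoreSupplierLandau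

open Literature.MathematicalPhysics.QuantumFieldTheory.Balaban1983to89
open B7Prop1Explicit (Site e expUnit val_expUnit val_inv_expUnit)
open B7Eq78Linearization (conjR conjR_apply)
open B7Eq92Concrete (mgauge mgauge_apply Rc_one_apply)
open B8Ineq132 (covDeriv covDerivFwd)
open B8Eq151V2Divergence (covDeriv_eq_neg_conjR_covDerivFwd)
open B8Eq138LandauZd (covDivB covLap QT IsLandau138W)
open B8Eq182Proof (gAd)
open B8Eq184Proof (gaugeExp cfgExp)
open B8Eq188Proof (frakF3)
open B8Eq191FlatStencils (conjR_unitOne conjR_unitOne_inv)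
open B8LambdaSpaceKLevel (wt)
open B8Prop5KLevelLetters (isLandau138W_gaugeFixed_of_multiplier)
open Literature.Analysis.Calculus (norm_exp_sub_one_le)

variable {d : ℕ} {𝔸 : Type*} [NormedRing 𝔸] [NormedAlgebra ℂ 𝔸] [NormOneClass 𝔸] [CompleteSpace 𝔸]

/-! ## §1 [R-d] The Landau condition of record from the top step's output -/

omit [CompleteSpace 𝔸] in
/-- the level-`0` weight is the spacing: `L⁰η = η`. [cite: Balaban1985RegularSpaces, p.86] -/
theorem wt_zero (L : ℕ) (η : ℝ) : wt L η 0 = η := by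
  rw [wt, pow_zero, one_mul]

/-- ★★ **N05's LANDAU CONDITION OF RECORD FOR THE GAUGE-FIXED FIELD, FROM THE TOP STEP's OUTPUT.**  See the module docstring.  Hypotheses: `hEbΩ` (stars of `Ω₀` in `Eb₀`),
`h108` ((1.108) at level `0`), `hA` (the input's level-`0` size row), the windows `α₄ ≤ 1∕70`, `c_A ≤ 1∕12`, `hmult` (✓p636261's conjunct 4 VERBATIM at `Ω 0 := Ω₀`).
[cite: Balaban1985RegularSpaces, (1.38) p.82, (1.86)-(1.90) p.91, (1.107)-(1.108) p.94] -/
theorem isLandau138W_of_topStepOutput (hd : 0 < d) {η : ℝ} (hη : 0 < η) (L m : ℕ) (Ω₀ : Set (Site d)) (Λs : ℕ → Set (Site d))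
    (Eb₀ : Set (Site d × Fin d)) (hEbΩ : ∀ x ∈ Ω₀, ∀ μ : Fin d, (x, μ) ∈ Eb₀ ∧ (x - e μ, μ) ∈ Eb₀)
    {A : Site d → Fin d → 𝔸} {lam : Site d → 𝔸} {α₄ cA : ℝ} (hα : α₄ ≤ 1 / 70) (hcA : cA ≤ 1 / 12)
    (h108 : ∀ p ∈ Eb₀, ‖lam p.1‖ ≤ α₄ ∧ wt L η 0 * ‖covDerivFwd η (1 : Site d → Fin d → 𝔸ˣ) p.2 lam p.1‖ ≤ α₄)
    (hA : ∀ x ∈ Ω₀, ∀ μ : Fin d,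
      wt L η 0 * ‖A x μ‖ ≤ cA ∧ wt L η 0 * ‖conjR ((1 : Site d → Fin d → 𝔸ˣ) (x - e μ) μ)⁻¹ (A (x - e μ) μ)‖ ≤ cA)
    (hmult : ∃ μ : ℕ → Site d → 𝔸, ∀ x ∈ Ω₀,
      covLap η (1 : Site d → Fin d → 𝔸ˣ) (Ω₀.indicator fun y =>
        covDivB η (1 : Site d → Fin d → 𝔸ˣ) A y + covLap η (1 : Site d → Fin d → 𝔸ˣ) lam y +
        ((conjR (gaugeExp lam y)⁻¹ (covDivB η (1 : Site d → Fin d → 𝔸ˣ) A y) - covDivB η (1 : Site d → Fin d → 𝔸ˣ) A y) +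
          (gAd (covLap η (1 : Site d → Fin d → 𝔸ˣ) lam y) (lam y) - covLap η (1 : Site d → Fin d → 𝔸ˣ) lam y) +
          ∑ μ, frakF3 η (1 : Site d → Fin d → 𝔸ˣ) lam A y μ)) x = QT L m Λs (1 : Site d → Fin d → 𝔸ˣ) μ x) :
    IsLandau138W L m η Ω₀ Λs (1 : Site d → Fin d → 𝔸ˣ) (mgauge (1 : Site d → Fin d → 𝔸ˣ) (gaugeExp lam)⁻¹ (cfgExp η A)) := by
  have hwt : wt L η 0 = η := wt_zero L η
  refine isLandau138W_gaugeFixed_of_multiplier hη L m Ω₀ Λs (1 : Site d → Fin d → 𝔸ˣ) A ?_ ?_ ?_ ?_ hmult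
  · -- `‖λ(x)‖ ≤ 1∕12` on `Ω₀`
    intro x hx
    have h := (h108 (x, ⟨0, hd⟩) (hEbΩ x hx ⟨0, hd⟩).1).1
    exact h.trans (hα.trans (by norm_num))
  · -- `η‖(D^η_{1,μ}λ)(x)‖ ≤ 1∕70`
    intro x hx μ
    have h := (h108 (x, μ) (hEbΩ x hx μ).1).2
    rw [hwt] at h
    exact h.trans hα
  · -- `η‖(D^{η*}_{1,μ}λ)(x)‖ ≤ 1∕70` through `D* λ(x) = −R(1)(Dλ)(x − e_μ)`
    intro x hx μ
    have h := (h108 (x - e μ, μ) (hEbΩ x hx μ).2).2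
    rw [hwt] at h
    rw [covDeriv_eq_neg_conjR_covDerivFwd, norm_neg, Pi.one_apply, Pi.one_apply, conjR_unitOne_inv]
    exact h.trans hα
  · -- `η‖R(·)A(x − e_μ, μ)‖ ≤ 1∕12`
    intro x hx μ
    have h := (hA x hx μ).2
    rw [hwt] at h
    exact h.trans hcA

/-! ## §2 [R-b] The near-`1` size of the gauge-fixed bond variables -/

omit [NormOneClass 𝔸] in
/-- `‖e^X − 1‖ ≤ e^{s} − 1` for `‖X‖ ≤ s` (✓`Literature.Analysis.Calculus.norm_exp_sub_one_le`). [folklore] -/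
theorem norm_exp_sub_one_le_of_le {X : 𝔸} {s : ℝ} (h : ‖X‖ ≤ s) : ‖exp X - 1‖ ≤ Real.exp s - 1 :=
  (norm_exp_sub_one_le X).trans (by gcongr)

omit [NormOneClass 𝔸] in
/-- ★ **THE GAUGE-FIXED BOND VARIABLE IS NEAR `1`**: `‖e^{−iλ(z)}·e^{iηA(z,ν)}·e^{iλ(z+e_ν)} − 1‖ ≤ e^{2α₄ + c} − 1` for `‖λ(z)‖, ‖λ(z + e_ν)‖ ≤ α₄`, `η‖A(z,ν)‖ ≤ c`
(`0 ≤ η`). [cite: Balaban1985RegularSpaces, (1.84) p.90, (1.36) p.82; Balaban1985Averaging, (55) p.27] -/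
theorem norm_mgauge_gaugeFixed_sub_one_le {η : ℝ} (hη : 0 ≤ η) {A : Site d → Fin d → 𝔸} {lam : Site d → 𝔸} {α₄ c : ℝ}
    (z : Site d) (ν : Fin d) (hl0 : ‖lam z‖ ≤ α₄) (hl1 : ‖lam (z + e ν)‖ ≤ α₄) (hAz : η * ‖A z ν‖ ≤ c) :
    ‖((mgauge (1 : Site d → Fin d → 𝔸ˣ) (gaugeExp lam)⁻¹ (cfgExp η A) z ν : 𝔸ˣ) : 𝔸) - 1‖ ≤ Real.exp (2 * α₄ + c) - 1 := by
  rw [mgauge_apply, Pi.one_apply, Pi.one_apply, Rc_one_apply, Pi.inv_apply, Pi.inv_apply, inv_inv, gaugeExp, gaugeExp, cfgExp,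
    val_inv_expUnit, Units.val_mul, Units.val_mul, val_expUnit, val_expUnit, val_expUnit]
  have h1 : ‖exp (-(I • lam z)) - 1‖ ≤ Real.exp α₄ - 1 :=
    norm_exp_sub_one_le_of_le (by rw [norm_neg, norm_smul, Complex.norm_I, one_mul]; exact hl0)
  have h2 : ‖exp (I • (η • A z ν)) - 1‖ ≤ Real.exp c - 1 :=
    norm_exp_sub_one_le_of_le (by rw [norm_smul, Complex.norm_I, one_mul, norm_smul, Real.norm_of_nonneg hη]; exact hAz)
  have h3 : ‖exp (I • lam (z + e ν)) - 1‖ ≤ Real.exp α₄ - 1 :=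
    norm_exp_sub_one_le_of_le (by rw [norm_smul, Complex.norm_I, one_mul]; exact hl1)
  -- products of near-`1` elements (`ab − 1 = (a−1)(b−1) + (a−1) + (b−1)`; the tree's `NE1p.B7AveragingCommutator.norm_mul_sub_one_le_exp`, not importable here)
  have hprod : ∀ {a b : 𝔸} {s t : ℝ}, ‖a - 1‖ ≤ Real.exp s - 1 → ‖b - 1‖ ≤ Real.exp t - 1 → ‖a * b - 1‖ ≤ Real.exp (s + t) - 1 := by
    intro a b s t ha hb
    have hid : a * b - 1 = (a - 1) * (b - 1) + ((a - 1) + (b - 1)) := by noncomm_ring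
    have h0a : 0 ≤ Real.exp s - 1 := (norm_nonneg _).trans ha
    rw [hid, Real.exp_add]
    calc ‖(a - 1) * (b - 1) + ((a - 1) + (b - 1))‖ ≤ ‖a - 1‖ * ‖b - 1‖ + (‖a - 1‖ + ‖b - 1‖) :=
          (norm_add_le _ _).trans (add_le_add (norm_mul_le _ _) (norm_add_le _ _))
      _ ≤ (Real.exp s - 1) * (Real.exp t - 1) + ((Real.exp s - 1) + (Real.exp t - 1)) := by gcongr
      _ = Real.exp s * Real.exp t - 1 := by ring
  have h := hprod (hprod h1 h2) h3
  rwa [show α₄ + c + α₄ = 2 * α₄ + c by ring] at h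

omit [NormOneClass 𝔸] in
/-- ★ **… HENCE WITHIN `1∕4` OF `1`** at print's windows `α₄ ≤ 1∕70`, `c ≤ 1∕12` (`e^{x} ≤ 1 + x + x²` for `|x| ≤ 1`): the `hnear` row of
✓`HalvingP1FlatCoreSupplierDoor.hSup_of_contentRows` at one bond. [cite: Balaban1985RegularSpaces, (1.36) p.82, (1.108) p.94] -/
theorem norm_mgauge_gaugeFixed_sub_one_le_quarter {η : ℝ} (hη : 0 ≤ η) {A : Site d → Fin d → 𝔸} {lam : Site d → 𝔸} {α₄ c : ℝ}
    (hα0 : 0 ≤ α₄) (hα : α₄ ≤ 1 / 70) (hc0 : 0 ≤ c) (hc : c ≤ 1 / 12)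
    (z : Site d) (ν : Fin d) (hl0 : ‖lam z‖ ≤ α₄) (hl1 : ‖lam (z + e ν)‖ ≤ α₄) (hAz : η * ‖A z ν‖ ≤ c) :
    ‖((mgauge (1 : Site d → Fin d → 𝔸ˣ) (gaugeExp lam)⁻¹ (cfgExp η A) z ν : 𝔸ˣ) : 𝔸) - 1‖ ≤ 1 / 4 := by
  refine (norm_mgauge_gaugeFixed_sub_one_le hη z ν hl0 hl1 hAz).trans ?_
  set x : ℝ := 2 * α₄ + c with hx
  have hx0 : 0 ≤ x := by rw [hx]; positivity
  have hx1 : x ≤ 1 / 8 := by rw [hx]; linarith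
  have hb := Real.abs_exp_sub_one_sub_id_le (show |x| ≤ 1 by rw [abs_of_nonneg hx0]; linarith)
  have h2 : Real.exp x ≤ 1 + x + x ^ 2 := by
    have := (abs_le.1 hb).2
    linarith
  nlinarith


/-! ## §3 (v1.1) The two rows from the top-step call's OUTPUT, in one stroke (STAGE 3c of the (A-1) knit) -/

/-- ★★ **[R-d] + [R-b] OF ✓`HalvingP1FlatCoreSupplierDoor.hSup_of_contentRows` FROM THE TOP-STEP CALL's OUTPUT** (✓`HalvingP1FlatCoreSupplierTopCall.topRows_of_datum`'s
conjuncts 2 (support), 3 at `j = 0` ((1.108) on the sides touching `Ω₀`), 4 (multiplier form) and 7 (the level-`0` size of `A`), at any Dirichlet window `Ω₀` and tower `Λs`):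
N05's Landau condition of record for the gauge-fixed field `W^λ = mgauge 1 (e^{iλ})⁻¹ (e^{iηA})` AND its near-`1` size `‖W^λ(z,ν) − 1‖ ≤ 1∕4` at every `z ∈ Ω₀` — for `2 ≤ d`,
`0 ≤ α₄ ≤ 1∕70`, `0 ≤ c_A ≤ 1∕12` (`‖λ‖ ≤ α₄` EVERYWHERE: on the stars of `Ω₀` by (1.108), off `Ω₀` because `λ = 0`).
[cite: Balaban1985RegularSpaces, (1.36)-(1.38) p.82, (1.107)-(1.109) p.94] -/
theorem landau_and_near_of_topStepOutput (hd2 : 2 ≤ d) {η : ℝ} (hη : 0 < η) (L m : ℕ) (Ω₀ : Set (Site d)) (Λs : ℕ → Set (Site d))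
    {A : Site d → Fin d → 𝔸} {lam : Site d → 𝔸} {α₄ cA : ℝ} (hα0 : 0 ≤ α₄) (hα : α₄ ≤ 1 / 70) (hcA0 : 0 ≤ cA) (hcA : cA ≤ 1 / 12)
    (hsupp : ∀ x, x ∉ Ω₀ → lam x = 0)
    (h108 : ∀ b ∈ {b : Site d × Fin d | B8Eq140Level.SideTouches Ω₀ b.1 b.2},
      ‖lam b.1‖ ≤ α₄ ∧ wt L η 0 * ‖covDerivFwd η (1 : Site d → Fin d → 𝔸ˣ) b.2 lam b.1‖ ≤ α₄)
    (hA : ∀ x ∈ Ω₀, ∀ μ : Fin d,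
      wt L η 0 * ‖A x μ‖ ≤ cA ∧ wt L η 0 * ‖conjR ((1 : Site d → Fin d → 𝔸ˣ) (x - e μ) μ)⁻¹ (A (x - e μ) μ)‖ ≤ cA)
    (hmult : ∃ μ : ℕ → Site d → 𝔸, ∀ x ∈ Ω₀,
      covLap η (1 : Site d → Fin d → 𝔸ˣ) (Ω₀.indicator fun y =>
        covDivB η (1 : Site d → Fin d → 𝔸ˣ) A y + covLap η (1 : Site d → Fin d → 𝔸ˣ) lam y +
        ((conjR (gaugeExp lam y)⁻¹ (covDivB η (1 : Site d → Fin d → 𝔸ˣ) A y) - covDivB η (1 : Site d → Fin d → 𝔸ˣ) A y) +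
          (gAd (covLap η (1 : Site d → Fin d → 𝔸ˣ) lam y) (lam y) - covLap η (1 : Site d → Fin d → 𝔸ˣ) lam y) +
          ∑ μ, frakF3 η (1 : Site d → Fin d → 𝔸ˣ) lam A y μ)) x = QT L m Λs (1 : Site d → Fin d → 𝔸ˣ) μ x) :
    IsLandau138W L m η Ω₀ Λs (1 : Site d → Fin d → 𝔸ˣ) (mgauge (1 : Site d → Fin d → 𝔸ˣ) (gaugeExp lam)⁻¹ (cfgExp η A)) ∧
    ∀ z ∈ Ω₀, ∀ ν : Fin d, ‖((mgauge (1 : Site d → Fin d → 𝔸ˣ) (gaugeExp lam)⁻¹ (cfgExp η A) z ν : 𝔸ˣ) : 𝔸) - 1‖ ≤ 1 / 4 := by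
  have hd : 0 < d := by omega
  -- `‖λ‖ ≤ α₄` everywhere
  have hlam : ∀ x, ‖lam x‖ ≤ α₄ := by
    intro x
    by_cases hx : x ∈ Ω₀
    · exact (h108 (x, ⟨0, hd⟩) (B8Prop5SocketDatum.sideTouches_pair_of_mem hd2 hx ⟨0, hd⟩).1).1
    · rw [hsupp x hx, norm_zero]; exact hα0
  refine ⟨isLandau138W_of_topStepOutput hd hη L m Ω₀ Λs {b : Site d × Fin d | B8Eq140Level.SideTouches Ω₀ b.1 b.2}
    (fun x hx μ => B8Prop5SocketDatum.sideTouches_pair_of_mem hd2 hx μ) hα hcA h108 hA hmult, fun z hz ν => ?_⟩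
  have hAz : η * ‖A z ν‖ ≤ cA := by
    have h := (hA z hz ν).1
    rwa [wt_zero] at h
  exact norm_mgauge_gaugeFixed_sub_one_le_quarter hη.le hα0 hα hcA0 hcA z ν (hlam z) (hlam (z + e ν)) hAz

end Summit.QuantumFields.YangMills.Theorems.HalvingP1FlatCoreSupplierLandau

end
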